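import Mathlib
import Summits.NavierStokesRegularity.FluidComputer.AbcClassIISymmetry
import Summits.NavierStokesRegularity.FluidComputer.AbcLatticePairingBound

/-!
# Class-II layer of the skew-cut X0 chain, Part B: the orbit-adapted basis families
(instab4 g6 — implementation 2 of the skew-cut X0 certifier, cell `ns-blowup`, 2026-08-26)

HONEST FRAMING (human ruling D-0035): nothing here is a claim about Navier–Stokes blow-up.
WHAT THIS IS NOT: not NS evidence. MODEL lane. Sequel of `AbcClassIIDefs` / `AbcClassIIOrbits` /
`AbcClassIISymmetry`: the properties (B1)–(B5) of the basis families `bfam i` (`i : Idx`, an orbit and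
an index of the `stdOrthonormalBasis` of the real class-II space `realSpace O` of that orbit):

* `extend` / `restrictTo` dictionary; `inner_eq_sum_extend` (the Euclidean inner product is the sum of
  the pointwise `ℂ³` pairings of the families); `conj_sum_inner_of_isConjSymm` (pairings of
  conjugate-symmetric families over symmetric frequency sets are REAL); `inner_coe_realSpace` (on
  `realSpace S` the complex pairing is the real inner product);
* `bfam_spec` (supported on one orbit, transversal, class II, conjugate-symmetric), `sum_inner_bfam`
  (COMPLEX orthonormality over any frequency set containing the orbit), `expand_real` /
  `expand_complex` / `eq_zero_of_orthogonal` (real and complex COMPLETENESS on each orbit: a transversal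
  class-II family supported in an orbit is the combination of the `bfam` with coefficients its pairings;
  via `c = ½((c + Jc) − i·i(c − Jc))`), `odim_le` (`d_O ≤ 288`).

Mathlib + the files named; no new definitions.
-/

noncomputable section

open scoped BigOperators ComplexConjugate InnerProductSpace
open Finset MeasureTheory UnitAddTorus

namespace Summit.NavierStokesRegularity.FluidComputer.AbcClassII

open Literature.Analysis.FunctionSpaces Literature.Analysis.FunctionSpaces.Torus
open Literature.Analysis.FunctionSpaces.EuclideanSpace
open Literature.Analysis.FluidPDE Literature.Analysis.FluidPDE.SteadyLattice
open Literature.Analysis.FluidPDE.ScalarFourier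

/-! ## Part B. The orbit-adapted basis families (instab4 g6) -/

section Basis

variable {S : Finset (Fin 3 → ℤ)}

/-- Values of an extended vector on its support. -/
theorem extend_apply_of_mem (x : EuclideanSpace ℂ (↥S × Fin 3)) {k : Fin 3 → ℤ} (hk : k ∈ S) (p : Fin 3) :
    extend S x k p = x (⟨k, hk⟩, p) := by
  simp [extend, hk]

/-- An extended vector vanishes off `S`. -/
theorem extend_apply_of_not_mem (x : EuclideanSpace ℂ (↥S × Fin 3)) {k : Fin 3 → ℤ} (hk : k ∉ S) :
    extend S x k = 0 := by
  ext p; simp [extend, hk]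

/-- `restrictTo ∘ extend = id`. -/
theorem restrictTo_extend (x : EuclideanSpace ℂ (↥S × Fin 3)) : restrictTo S (extend S x) = x := by
  ext kp
  obtain ⟨⟨k, hk⟩, p⟩ := kp
  simp [restrictTo, extend]

/-- `extend ∘ restrictTo = id` on families supported in `S`. -/
theorem extend_restrictTo (c : Fam) (hc : ∀ k ∉ S, c k = 0) : extend S (restrictTo S c) = c := by
  funext k; ext p
  by_cases hk : k ∈ S
  · simp [extend, restrictTo, hk]
  · simp [extend, hk, hc k hk]

/-- `extend` through finite sums. -/
theorem extend_sum {α : Type*} (s : Finset α) (f : α → EuclideanSpace ℂ (↥S × Fin 3)) :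
    extend S (∑ a ∈ s, f a) = ∑ a ∈ s, extend S (f a) := by
  classical
  induction s using Finset.induction_on with
  | empty => simp [extend_zero]
  | insert a s ha ih => rw [Finset.sum_insert ha, Finset.sum_insert ha, extend_add, ih]

/-- Equality of basis indices: same orbit and (heterogeneously) same basis index. -/
theorem idx_eq_iff (i j : Idx) : i = j ↔ i.1 = j.1 ∧ HEq i.2 j.2 := by
  obtain ⟨O, a⟩ := i
  obtain ⟨O', a'⟩ := j
  exact Sigma.mk.inj_iff

/-- The Euclidean inner product is the sum over `S` of the pointwise `ℂ³` inner products of the families. -/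
theorem inner_eq_sum_extend (x y : EuclideanSpace ℂ (↥S × Fin 3)) :
    (inner ℂ x y : ℂ) = ∑ k ∈ S, (inner ℂ (extend S x k) (extend S y k) : ℂ) := by
  rw [PiLp.inner_apply, Fintype.sum_prod_type, ← Finset.sum_coe_sort S]
  refine Finset.sum_congr rfl fun k _ => ?_
  rw [PiLp.inner_apply]
  refine Finset.sum_congr rfl fun p _ => ?_
  have h : ∀ z : EuclideanSpace ℂ (↥S × Fin 3), extend S z k p = z (k, p) := fun z => by
    rw [extend_apply_of_mem z k.2]
  rw [h, h]

/-- `⟪conj a, conj b⟫ = ⟪b, a⟫` in `ℂ³`. [folklore] -/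
theorem inner_conjVec_conjVec (a b : EuclideanSpace ℂ (Fin 3)) :
    (inner ℂ (conjVec a) (conjVec b) : ℂ) = inner ℂ b a := by
  rw [AbcLatticePairingSplit.inner_fin3_eq_sum, AbcLatticePairingSplit.inner_fin3_eq_sum]
  refine Finset.sum_congr rfl fun p _ => ?_
  simp only [conjVec_apply, RingHomCompTriple.comp_apply, RingHom.id_apply]
  ring

/-- **Reality of the pairing of conjugate-symmetric families** over a frequency set symmetric under
`k ↦ −k`: `conj Σ_{k∈S} ⟪f k, g k⟫ = Σ_{k∈S} ⟪f k, g k⟫`. -/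
theorem conj_sum_inner_of_isConjSymm {f g : Fam} (hf : Torus.IsConjSymm f) (hg : Torus.IsConjSymm g)
    (hS : ∀ k ∈ S, -k ∈ S) :
    (starRingEnd ℂ) (∑ k ∈ S, (inner ℂ (f k) (g k) : ℂ)) = ∑ k ∈ S, (inner ℂ (f k) (g k) : ℂ) := by
  rw [map_sum]
  have h1 : ∀ k, (starRingEnd ℂ) (inner ℂ (f k) (g k) : ℂ) = (inner ℂ (f (-k)) (g (-k)) : ℂ) := by
    intro k
    rw [inner_conj_symm, hf k, hg k, inner_conjVec_conjVec]
  simp_rw [h1]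
  exact Finset.sum_nbij' (fun k => -k) (fun k => -k) (fun k hk => hS k hk) (fun k hk => hS k hk)
    (fun k _ => neg_neg k) (fun k _ => neg_neg k) (fun k _ => rfl)

/-- The pairing of conjugate-symmetric families over a symmetric set is a real number. -/
theorem sum_inner_eq_re_of_isConjSymm {f g : Fam} (hf : Torus.IsConjSymm f) (hg : Torus.IsConjSymm g)
    (hS : ∀ k ∈ S, -k ∈ S) :
    ∑ k ∈ S, (inner ℂ (f k) (g k) : ℂ) = (((∑ k ∈ S, (inner ℂ (f k) (g k) : ℂ)).re : ℝ) : ℂ) := by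
  have h := conj_sum_inner_of_isConjSymm hf hg hS
  exact (Complex.conj_eq_iff_re.mp h).symm

/-- The real (`PiLp` over `ℝ`) inner product of the complex Euclidean space is the real part of the
complex one. [folklore] -/
theorem real_inner_eq_re (x y : EuclideanSpace ℂ (↥S × Fin 3)) : (inner ℝ x y : ℝ) = (inner ℂ x y : ℂ).re := by
  rw [PiLp.inner_apply, PiLp.inner_apply, Complex.re_sum]
  refine Finset.sum_congr rfl fun i _ => ?_
  simp [Complex.inner, mul_comm]

/-- **On the real class-II space of a symmetric set, the complex inner product IS the real one.** -/
theorem inner_coe_realSpace (hS : ∀ k ∈ S, -k ∈ S) (u v : realSpace S) :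
    (inner ℂ (u : EuclideanSpace ℂ (↥S × Fin 3)) (v : EuclideanSpace ℂ (↥S × Fin 3)) : ℂ) =
      ((inner ℝ u v : ℝ) : ℂ) := by
  have hre : (inner ℝ u v : ℝ) = (inner ℂ (u : EuclideanSpace ℂ (↥S × Fin 3))
      (v : EuclideanSpace ℂ (↥S × Fin 3)) : ℂ).re := real_inner_eq_re _ _
  rw [hre, inner_eq_sum_extend]
  exact sum_inner_eq_re_of_isConjSymm u.2.2.2 v.2.2.2 hS

/-! ### The basis families -/

/-- Unfolding `bfam`. -/
theorem bfam_eq (i : Idx) :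
    bfam i = extend i.1.1 ((orbitBasis i.1 i.2 : realSpace i.1.1) : EuclideanSpace ℂ (↥i.1.1 × Fin 3)) := rfl

/-- The basis family `bfam i` vanishes off its orbit. -/
theorem bfam_apply_of_not_mem (i : Idx) {k : Fin 3 → ℤ} (hk : k ∉ i.1.1) : bfam i k = 0 :=
  extend_apply_of_not_mem _ hk

/-- The basis family `bfam i` is transversal, class II and conjugate-symmetric. -/
theorem bfam_spec (i : Idx) :
    (∀ k : Fin 3 → ℤ, ∑ j : Fin 3, ((k j : ℤ) : ℂ) * bfam i k j = 0) ∧ IsClassII (bfam i) ∧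
      Torus.IsConjSymm (bfam i) :=
  (orbitBasis i.1 i.2).2

/-- **Orthonormality on one orbit**: `Σ_{k ∈ O} ⟪bfam ⟨O,a⟩ k, bfam ⟨O,a'⟩ k⟫ = δ_{a a'}`. -/
theorem sum_inner_bfam_same_orbit (O : Orbit) (a a' : Fin (odim O)) :
    ∑ k ∈ O.1, (inner ℂ (bfam ⟨O, a⟩ k) (bfam ⟨O, a'⟩ k) : ℂ) = if a = a' then 1 else 0 := by
  rw [bfam_eq, bfam_eq, ← inner_eq_sum_extend,
    inner_coe_realSpace (neg_mem_of_orbitClosed O.orbitClosed) (orbitBasis O a) (orbitBasis O a'),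
    orthonormal_iff_ite.mp (orbitBasis O).orthonormal a a']
  split_ifs <;> simp

/-- **Orthonormality of the basis families** over any frequency set containing the orbit of `i`:
`Σ_{k ∈ T} ⟪bfam i k, bfam j k⟫ = δ_{ij}`. -/
theorem sum_inner_bfam {T : Finset (Fin 3 → ℤ)} {i : Idx} (hi : i.1.1 ⊆ T) (j : Idx) :
    ∑ k ∈ T, (inner ℂ (bfam i k) (bfam j k) : ℂ) = if i = j then 1 else 0 := by
  obtain ⟨O, a⟩ := i
  obtain ⟨O', a'⟩ := j
  by_cases hO : O = O'
  · subst hO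
    -- reduce to the orbit
    have h : ∑ k ∈ T, (inner ℂ (bfam ⟨O, a⟩ k) (bfam ⟨O, a'⟩ k) : ℂ) =
        ∑ k ∈ O.1, (inner ℂ (bfam ⟨O, a⟩ k) (bfam ⟨O, a'⟩ k) : ℂ) := by
      refine (Finset.sum_subset hi fun k _ hk => ?_).symm
      rw [bfam_apply_of_not_mem ⟨O, a⟩ hk, inner_zero_left]
    rw [h, sum_inner_bfam_same_orbit]
    by_cases ha : a = a'
    · subst ha; simp
    · rw [if_neg ha]
      split_ifs with he
      · exact absurd (eq_of_heq ((idx_eq_iff _ _).mp he).2) ha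
      · rfl
  · split_ifs with he
    · exact absurd ((idx_eq_iff _ _).mp he).1 hO
    refine Finset.sum_eq_zero fun k _ => ?_
    by_cases hk : k ∈ O.1
    · have hk' : k ∉ O'.1 := fun h' => Finset.disjoint_left.mp (Orbit.disjoint_of_ne hO) hk h'
      rw [bfam_apply_of_not_mem ⟨O', a'⟩ hk', inner_zero_right]
    · rw [bfam_apply_of_not_mem ⟨O, a⟩ hk, inner_zero_left]

/-- The restriction of a transversal, class-II, conjugate-symmetric family supported in `S` lies in
`realSpace S`. -/
theorem restrictTo_mem_realSpace {c : Fam} (hsupp : ∀ k ∉ S, c k = 0)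
    (hct : ∀ k : Fin 3 → ℤ, ∑ j : Fin 3, ((k j : ℤ) : ℂ) * c k j = 0) (hcII : IsClassII c)
    (hcJ : Torus.IsConjSymm c) : restrictTo S c ∈ realSpace S := by
  refine ⟨?_, ?_, ?_⟩ <;> rw [extend_restrictTo c hsupp]
  exacts [hct, hcII, hcJ]

/-- Real scalars act through `ℂ` on the Euclidean space. -/
theorem real_smul_eq (r : ℝ) (x : EuclideanSpace ℂ (↥S × Fin 3)) : r • x = (r : ℂ) • x := rfl

/-- **Real completeness on one orbit**: a transversal, class-II, conjugate-symmetric family supported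
in an orbit is the REAL combination of the basis families with coefficients the real inner products. -/
theorem expand_real (O : Orbit) {c : Fam} (hsupp : ∀ k ∉ O.1, c k = 0)
    (hct : ∀ k : Fin 3 → ℤ, ∑ j : Fin 3, ((k j : ℤ) : ℂ) * c k j = 0) (hcII : IsClassII c)
    (hcJ : Torus.IsConjSymm c) :
    c = ∑ a : Fin (odim O), ((inner ℝ (orbitBasis O a)
      (⟨restrictTo O.1 c, restrictTo_mem_realSpace hsupp hct hcII hcJ⟩ : realSpace O.1) : ℝ) : ℂ) •
        bfam ⟨O, a⟩ := by
  set u : realSpace O.1 := ⟨restrictTo O.1 c, restrictTo_mem_realSpace hsupp hct hcII hcJ⟩ with hu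
  have h : ∑ a : Fin (odim O), (inner ℝ (orbitBasis O a) u : ℝ) • orbitBasis O a = u := by
    have := (orbitBasis O).sum_repr u
    simpa only [OrthonormalBasis.repr_apply_apply] using this
  have h1 : ((∑ a : Fin (odim O), (inner ℝ (orbitBasis O a) u : ℝ) • orbitBasis O a : realSpace O.1) :
      EuclideanSpace ℂ (↥O.1 × Fin 3)) = restrictTo O.1 c := by
    rw [h]
  rw [Submodule.coe_sum] at h1
  simp only [Submodule.coe_smul, real_smul_eq] at h1
  have h2 := congrArg (extend O.1) h1
  rw [extend_restrictTo c hsupp, extend_sum] at h2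
  rw [← h2]
  refine Finset.sum_congr rfl fun a _ => ?_
  rw [extend_smul, bfam_eq]

/-- **Coefficients of an expansion are the pairings with the basis families** (orthonormality). -/
theorem coeff_eq_sum_inner (O : Orbit) {c : Fam} {z : Fin (odim O) → ℂ}
    (h : c = ∑ a : Fin (odim O), z a • bfam ⟨O, a⟩) (a : Fin (odim O)) :
    z a = ∑ k ∈ O.1, (inner ℂ (bfam ⟨O, a⟩ k) (c k) : ℂ) := by
  rw [h]
  simp only [Finset.sum_apply, inner_sum, Pi.smul_apply, inner_smul_right]
  rw [Finset.sum_comm]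
  simp_rw [← Finset.mul_sum]
  have horth : ∀ a' : Fin (odim O), ∑ k ∈ O.1, (inner ℂ (bfam ⟨O, a⟩ k) (bfam ⟨O, a'⟩ k) : ℂ) =
      if (⟨O, a⟩ : Idx) = ⟨O, a'⟩ then 1 else 0 := fun a' => sum_inner_bfam (i := ⟨O, a⟩) le_rfl ⟨O, a'⟩
  simp_rw [horth]
  have hite : ∀ a' : Fin (odim O), (if (⟨O, a⟩ : Idx) = ⟨O, a'⟩ then (1 : ℂ) else 0) = if a = a' then 1 else 0 := by
    intro a'
    by_cases ha : a = a'
    · subst ha; simp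
    · rw [if_neg ha, if_neg]
      intro he; exact ha (eq_of_heq (Sigma.mk.inj_iff.mp he).2)
  simp_rw [hite, mul_ite, mul_one, mul_zero]
  rw [Finset.sum_ite_eq Finset.univ a]
  simp

/-- **Complex completeness on one orbit (existence)**: a transversal class-II family supported in an
orbit is a COMPLEX combination of the basis families (`c = ½((c + Jc) − i·i(c − Jc))`, both
`c + Jc` and `i(c − Jc)` being conjugate-symmetric, transversal and class II). -/
theorem exists_expand_complex (O : Orbit) {c : Fam} (hsupp : ∀ k ∉ O.1, c k = 0)
    (hct : ∀ k : Fin 3 → ℤ, ∑ j : Fin 3, ((k j : ℤ) : ℂ) * c k j = 0) (hcII : IsClassII c) :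
    ∃ z : Fin (odim O) → ℂ, c = ∑ a : Fin (odim O), z a • bfam ⟨O, a⟩ := by
  set J : Fam := fun k => conjVec (c (-k)) with hJ
  have hS := neg_mem_of_orbitClosed O.orbitClosed
  have hJsupp : ∀ k ∉ O.1, J k = 0 := fun k hk => conj_eq_zero_of_not_mem hS hsupp k hk
  have hJt : ∀ k : Fin 3 → ℤ, ∑ j : Fin 3, ((k j : ℤ) : ℂ) * J k j = 0 := kdot_conj hct
  have hJII : IsClassII J := hcII.conj
  -- g = c + Jc, h = i (c − Jc): conjugate-symmetric, transversal, class II, supported in O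
  have hg := expand_real O (c := c + J) (fun k hk => by simp [hsupp k hk, hJsupp k hk])
    (fun k => by rw [Pi.add_apply, kdot_add, hct k, hJt k, add_zero]) (hcII.add hJII)
    (AbcLatticeReality.isConjSymm_add_conj c)
  have hh := expand_real O (c := Complex.I • (c - J)) (fun k hk => by simp [hsupp k hk, hJsupp k hk])
    (fun k => by rw [Pi.smul_apply, kdot_smul, Pi.sub_apply, kdot_sub', hct k, hJt k, sub_zero, mul_zero])
    ((hcII.sub hJII).smul Complex.I) (AbcLatticeReality.isConjSymm_I_smul_sub_conj c)
  -- abbreviate the real coefficient vectors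
  obtain ⟨r, hg⟩ : ∃ r : Fin (odim O) → ℂ, c + J = ∑ a : Fin (odim O), r a • bfam ⟨O, a⟩ := ⟨_, hg⟩
  obtain ⟨s, hh⟩ : ∃ s : Fin (odim O) → ℂ, Complex.I • (c - J) = ∑ a : Fin (odim O), s a • bfam ⟨O, a⟩ :=
    ⟨_, hh⟩
  refine ⟨fun a => (1 / 2 : ℂ) * (r a - Complex.I * s a), ?_⟩
  have key : c = (1 / 2 : ℂ) • ((c + J) - Complex.I • (Complex.I • (c - J))) := by
    funext k; ext p
    simp only [Pi.smul_apply, Pi.add_apply, Pi.sub_apply, PiLp.smul_apply, PiLp.add_apply,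
      PiLp.sub_apply, smul_eq_mul]
    ring_nf
    rw [Complex.I_sq]
    ring
  calc c = (1 / 2 : ℂ) • ((c + J) - Complex.I • (Complex.I • (c - J))) := key
    _ = (1 / 2 : ℂ) • ((∑ a : Fin (odim O), r a • bfam ⟨O, a⟩) -
          Complex.I • ∑ a : Fin (odim O), s a • bfam ⟨O, a⟩) := by
        rw [← hh, ← hg]
    _ = ∑ a : Fin (odim O), ((1 / 2 : ℂ) * (r a - Complex.I * s a)) • bfam ⟨O, a⟩ := by
        rw [Finset.smul_sum, ← Finset.sum_sub_distrib, Finset.smul_sum]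
        refine Finset.sum_congr rfl fun a _ => ?_
        rw [smul_smul, ← sub_smul, smul_smul]

/-- **Complex completeness on one orbit**: a transversal class-II family supported in the orbit `O`
equals `Σ_a (Σ_{k∈O} ⟪bfam ⟨O,a⟩ k, c k⟫) • bfam ⟨O,a⟩`. In particular such a family orthogonal to all
`bfam ⟨O, a⟩` vanishes. -/
theorem expand_complex (O : Orbit) {c : Fam} (hsupp : ∀ k ∉ O.1, c k = 0)
    (hct : ∀ k : Fin 3 → ℤ, ∑ j : Fin 3, ((k j : ℤ) : ℂ) * c k j = 0) (hcII : IsClassII c) :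
    c = ∑ a : Fin (odim O), (∑ k ∈ O.1, (inner ℂ (bfam ⟨O, a⟩ k) (c k) : ℂ)) • bfam ⟨O, a⟩ := by
  obtain ⟨z, hz⟩ := exists_expand_complex O hsupp hct hcII
  have hz' : ∀ a, z a = ∑ k ∈ O.1, (inner ℂ (bfam ⟨O, a⟩ k) (c k) : ℂ) := coeff_eq_sum_inner O hz
  conv_lhs => rw [hz]
  exact Finset.sum_congr rfl fun a _ => by rw [hz' a]

/-- **A transversal class-II family supported in an orbit and orthogonal to its basis families is zero.** -/
theorem eq_zero_of_orthogonal (O : Orbit) {c : Fam} (hsupp : ∀ k ∉ O.1, c k = 0)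
    (hct : ∀ k : Fin 3 → ℤ, ∑ j : Fin 3, ((k j : ℤ) : ℂ) * c k j = 0) (hcII : IsClassII c)
    (horth : ∀ a : Fin (odim O), ∑ k ∈ O.1, (inner ℂ (bfam ⟨O, a⟩ k) (c k) : ℂ) = 0) : c = 0 := by
  rw [expand_complex O hsupp hct hcII]
  exact Finset.sum_eq_zero fun a _ => by rw [horth a, zero_smul]

/-- **The orbit dimension is uniformly bounded**: `odim O ≤ 288 = 2·3·48`. -/
theorem odim_le (O : Orbit) : odim O ≤ 288 := by
  have h1 : Module.finrank ℝ (realSpace O.1) ≤ Module.finrank ℝ (EuclideanSpace ℂ (↥O.1 × Fin 3)) :=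
    Submodule.finrank_le _
  have h2 : Module.finrank ℝ (EuclideanSpace ℂ (↥O.1 × Fin 3)) =
      2 * Module.finrank ℂ (EuclideanSpace ℂ (↥O.1 × Fin 3)) := finrank_real_of_complex _
  rw [finrank_euclideanSpace, Fintype.card_prod, Fintype.card_coe, Fintype.card_fin] at h2
  have h3 := O.card_le
  show Module.finrank ℝ (realSpace O.1) ≤ 288
  omega

end Basis

end Summit.NavierStokesRegularity.FluidComputer.AbcClassII

end
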